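import Summits.RiemannHypothesis.RiemannHypothesis.Theorems.GroundBartaPolarPerronFrobeniusEvenLimit
import Summits.RiemannHypothesis.RiemannHypothesis.Theorems.GroundBartaPolarPerronFrobeniusEvenKernel
import HarnessLib

/-!
# RiemannHypothesis / GroundBarta — crux `PolarPerronFrobenius` (stmt-RiemannHypothesis-18390):
# even-sector sign improvement, part E3b: the gain beats the polar loss; the main lemma at `a ≤ 1/4`

Helper file (`--supports stmt-RiemannHypothesis-18390`), RH-free, Mathlib + proved tree files only,
no definitions, no named facts.  Notation as in parts E1–E3a.

* `swe_kernel_xy`: at a pair `x ≠ ±y` in `[-a, a]`, `a ≤ 1/4`: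
  `4cosh(x/2)cosh(y/2) ≤ min(w|x−y|,5) + min(w|x+y|,5)` (part E1's kernel inequality);
* `swe_polar_le_gain`: for an EVEN real test on `[-a, a]`, `a ≤ 1/4`:  **`P(|f|) − P(f) ≤ Γ_0`**,
  `Γ_0 = ∫_{(0,∞)} min(w,5)(D_t f − D_t|f|)` (Fubini + reflection + kernel inequality at the pairs
  `f(x) < 0 < f(y)`);
* `swe_exists_nonneg_test_lt_even`: **MAIN LEMMA (even sector, `0 < a ≤ 1/4`)** — for an even real
  normalised window test `f` and `δ > 0` some smooth non-negative EVEN approximant `w_η = ψ_η ∘ f` has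
  `Re Q(w_η) < ‖w_η‖₂² (Re Q(f) + δ)`.  (Per `η`: `Re Q(w_η) − Re Q(f) ≤ [P(w_η) − P(f)] − Γ_η − M_a[N(w_η) − 1]`
  by the Markov decomposition and part E3a; as `η → 0⁺` the right side tends to
  `[P(|f|) − P(f)] − Γ_0 ≤ 0`.)  This doubles the window range of the parity-free theorem
  `sw_exists_nonneg_test_lt` (`a ≤ 1/10`) in the sector of the registered stub.

Prover B, speedrun unit `sr-gb-rung-b` (seat 2).
-/

set_option linter.dupNamespace false

noncomputable section

open Set MeasureTheory Filter Complex
open scoped Real Topology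

namespace Summit.RiemannHypothesis.RiemannHypothesis.Theorems.PolarPerronFrobenius

open Literature.NumberTheory.LFunctions

/-! ## The truncated gain dominates the polar loss (even `f`, `a ≤ 1/4`) -/

section GainPolar

variable {f : ℝ → ℝ} {a : ℝ}

/-- `|x − y| + |x + y| ≤ 2a` for `|x|, |y| ≤ a`. [folklore] -/
theorem swe_abs_sub_add_abs_add_le {x y a : ℝ} (hx : |x| ≤ a) (hy : |y| ≤ a) :
    |x - y| + |x + y| ≤ 2 * a := by
  obtain ⟨hx1, hx2⟩ := abs_le.1 hx
  obtain ⟨hy1, hy2⟩ := abs_le.1 hy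
  rcases le_total 0 (x - y) with h1 | h1 <;> rcases le_total 0 (x + y) with h2 | h2
  · rw [abs_of_nonneg h1, abs_of_nonneg h2]; linarith
  · rw [abs_of_nonneg h1, abs_of_nonpos h2]; linarith
  · rw [abs_of_nonpos h1, abs_of_nonneg h2]; linarith
  · rw [abs_of_nonpos h1, abs_of_nonpos h2]; linarith

/-- The symmetrised kernel against `4cosh(x/2)cosh(y/2)` at a pair of points of opposite sign:
for `0 < a ≤ 1/4`, `|x|, |y| ≤ a`, `x ≠ y`, `x ≠ -y`,
`4cosh(x/2)cosh(y/2) ≤ min(w|x−y|, 5) + min(w|x+y|, 5)`. [folklore] -/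
theorem swe_kernel_xy {x y : ℝ} (ha : 0 < a) (ha' : a ≤ 1 / 4) (hx : |x| ≤ a) (hy : |y| ≤ a)
    (hxy : x ≠ y) (hxy' : x ≠ -y) :
    4 * Real.cosh (x / 2) * Real.cosh (y / 2) ≤
      min (weilArchDensity |x - y|) 5 + min (weilArchDensity |x + y|) 5 := by
  have hs : 0 < |x - y| := abs_pos.2 (sub_ne_zero.2 hxy)
  have ht : 0 < |x + y| := abs_pos.2 fun h ↦ hxy' (by linarith)
  have hst := swe_abs_sub_add_abs_add_le hx hy
  have hk := swe_kernel_ge hs ht ha ha' hst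
  have e1 : Real.cosh (|x - y| / 2) = Real.cosh ((x - y) / 2) := by
    rw [show |x - y| / 2 = |(x - y) / 2| by rw [abs_div, abs_two], Real.cosh_abs]
  have e2 : Real.cosh (|x + y| / 2) = Real.cosh ((x + y) / 2) := by
    rw [show |x + y| / 2 = |(x + y) / 2| by rw [abs_div, abs_two], Real.cosh_abs]
  have e3 : Real.cosh ((x - y) / 2) + Real.cosh ((x + y) / 2) =
      2 * Real.cosh (x / 2) * Real.cosh (y / 2) := by
    rw [swe_cosh_add_cosh]
    have ea : ((x - y) / 2 + (x + y) / 2) / 2 = x / 2 := by ring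
    have eb : ((x - y) / 2 - (x + y) / 2) / 2 = -(y / 2) := by ring
    rw [ea, eb, Real.cosh_neg]
  rw [e1, e2] at hk
  linarith

/-- **The truncated Beurling–Deny gain dominates the polar loss** for an even real test on a window
`a ≤ 1/4`: with `Γ_0 = ∫_{(0,∞)} min(w,5)(D_t f − D_t |f|) dt`,
`P(|f|) − P(f) ≤ Γ_0`.
(`2Γ_0 = ∫_ℝ k·(D f − D|f|) = 4∫ f⁻(x) ∫ k(t)(f⁺(x+t)+f⁺(x−t)) dt dx = 4∫ f⁻(x) ∫ (k(x−y)+k(x+y)) f⁺(y) dy dx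
≥ 16 (∫f⁻cosh(·/2))(∫f⁺cosh(·/2)) = 2(P(|f|) − P(f))`, by the kernel inequality at the pairs
`f(x) < 0 < f(y)`, which lie in `[-a,a]` off the diagonals.) [folklore] -/
theorem swe_polar_le_gain (hf : ContDiff ℝ (⊤ : ℕ∞) f) (hfs : HasCompactSupport f)
    (ha : 0 < a) (ha' : a ≤ 1 / 4) (hsupp : tsupport f ⊆ Icc (-a) a) (hfe : ∀ t, f (-t) = f t) :
    weilPoleForm (fun t ↦ ((|f t| : ℝ) : ℂ)) - weilPoleForm (fun t ↦ ((f t : ℝ) : ℂ)) ≤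
      ∫ t in Ioi (0 : ℝ), min (weilArchDensity t) 5 *
        (weilIncrement (fun x ↦ ((f x : ℝ) : ℂ)) t - weilIncrement (fun x ↦ ((|f x| : ℝ) : ℂ)) t) := by
  have hfc : Continuous f := hf.continuous
  have hp : Continuous fun x ↦ max (f x) 0 := hfc.max continuous_const
  have hps := swe_hasCompactSupport_posPart hfs
  have hcosh : Continuous fun t : ℝ ↦ Real.cosh (t / 2) :=
    Real.continuous_cosh.comp (continuous_id.div_const 2)
  set Cp : ℝ := ∫ t, max (f t) 0 * Real.cosh (t / 2) with hCp
  set Cm : ℝ := ∫ t, max (-f t) 0 * Real.cosh (t / 2) with hCm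
  -- (1) `(0,∞) → ℝ`, increments → `x`-integral, Fubini
  set G : ℝ → ℝ := fun t ↦
    weilIncrement (fun x ↦ ((f x : ℝ) : ℂ)) t - weilIncrement (fun x ↦ ((|f x| : ℝ) : ℂ)) t with hGdef
  have hG : ∀ t, G (-t) = G t := fun t ↦ by
    simp only [hGdef, weilIncrement_neg]
  have h2 := swe_two_mul_gain_eq hG
  have h3 : ∫ t, min (weilArchDensity |t|) 5 * G t =
      ∫ t, min (weilArchDensity |t|) 5 *
        (4 * ∫ x, max (-f x) 0 * (max (f (x + t)) 0 + max (f (x - t)) 0)) :=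
    integral_congr_ae (Eventually.of_forall fun t ↦ by
      simp only [hGdef]; rw [swe_weilIncrement_sub_abs hfc hfs t])
  have h4 := swe_gain_fubini hfc hfs
  -- (2) the inner integral, symmetrised, dominates `4cosh(x/2) Cp` where `f(x) < 0`
  have h5 : ∀ x, ∫ t, min (weilArchDensity |t|) 5 * (max (f (x + t)) 0 + max (f (x - t)) 0) =
      ∫ y, (min (weilArchDensity |x - y|) 5 + min (weilArchDensity |x + y|) 5) * max (f y) 0 :=
    fun x ↦ by rw [swe_inner_eq hfc hfs, swe_inner_even hfc hfs hfe]
  have hpc : Integrable fun y ↦ max (f y) 0 * Real.cosh (y / 2) := sw_integrable_posPart_mul hfc hfs hcosh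
  have h6 : ∀ x, max (-f x) 0 * (4 * Real.cosh (x / 2) * Cp) ≤
      max (-f x) 0 * ∫ y, (min (weilArchDensity |x - y|) 5 + min (weilArchDensity |x + y|) 5) *
        max (f y) 0 := by
    intro x
    by_cases hx : f x < 0
    · have hxa : |x| ≤ a := by
        have hmem : x ∈ tsupport f := subset_tsupport f (Function.mem_support.2 hx.ne)
        exact abs_le.2 ⟨(hsupp hmem).1, (hsupp hmem).2⟩
      refine mul_le_mul_of_nonneg_left ?_ (le_max_right _ _)
      -- integrability of the kernel pairing
      have hk5 : ∀ s : ℝ, |min (weilArchDensity |s|) 5| ≤ 5 := fun s ↦ by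
        rw [abs_of_nonneg (swe_truncKernel_nonneg s)]; exact swe_truncKernel_le s
      have mK : Measurable fun y : ℝ ↦
          min (weilArchDensity |x - y|) 5 + min (weilArchDensity |x + y|) 5 :=
        (swe_measurable_truncKernel.comp (measurable_const.sub measurable_id)).add
          (swe_measurable_truncKernel.comp (measurable_const.add measurable_id))
      have hpi : Integrable fun y ↦ max (f y) 0 := hp.integrable_of_hasCompactSupport hps
      have iK : Integrable fun y ↦
          (min (weilArchDensity |x - y|) 5 + min (weilArchDensity |x + y|) 5) * max (f y) 0 := by
        refine Integrable.mono' (hpi.norm.const_mul 10) (mK.aestronglyMeasurable.mul hpi.aestronglyMeasurable)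
          (Eventually.of_forall fun y ↦ ?_)
        rw [norm_mul, Real.norm_eq_abs, Real.norm_eq_abs]
        refine mul_le_mul_of_nonneg_right ?_ (abs_nonneg _)
        calc |min (weilArchDensity |x - y|) 5 + min (weilArchDensity |x + y|) 5|
            ≤ |min (weilArchDensity |x - y|) 5| + |min (weilArchDensity |x + y|) 5| := abs_add_le _ _
          _ ≤ 5 + 5 := add_le_add (hk5 _) (hk5 _)
          _ = 10 := by norm_num
      calc 4 * Real.cosh (x / 2) * Cp = ∫ y, 4 * Real.cosh (x / 2) * (max (f y) 0 * Real.cosh (y / 2)) := by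
            rw [integral_const_mul]
        _ ≤ ∫ y, (min (weilArchDensity |x - y|) 5 + min (weilArchDensity |x + y|) 5) * max (f y) 0 := by
            refine integral_mono (hpc.const_mul _) iK fun y ↦ ?_
            simp only
            rcases eq_or_lt_of_le (le_max_right (f y) 0) with hy0 | hy0
            · rw [← hy0]; simp
            · have hfy : 0 < f y := by
                rcases lt_or_ge 0 (f y) with h | h
                · exact h
                · rw [max_eq_right h] at hy0; exact absurd hy0 (lt_irrefl 0)
              have hya : |y| ≤ a := by
                have hmem : y ∈ tsupport f := subset_tsupport f (Function.mem_support.2 hfy.ne')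
                exact abs_le.2 ⟨(hsupp hmem).1, (hsupp hmem).2⟩
              have hxy : x ≠ y := fun h ↦ by rw [h] at hx; linarith
              have hxy' : x ≠ -y := fun h ↦ by rw [h, hfe] at hx; linarith
              have hk := swe_kernel_xy ha ha' hxa hya hxy hxy'
              have hp0 : 0 ≤ max (f y) 0 := le_max_right _ _
              nlinarith
    · have h0 : max (-f x) 0 = 0 := max_eq_right (by linarith)
      rw [h0, zero_mul, zero_mul]
  -- (3) integrate in `x`
  have iM := swe_integrable_marginal hfc hfs
  have iM' : Integrable fun x ↦ max (-f x) 0 *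
      ∫ y, (min (weilArchDensity |x - y|) 5 + min (weilArchDensity |x + y|) 5) * max (f y) 0 :=
    iM.congr (Eventually.of_forall fun x ↦ by simp only; rw [h5 x])
  have hmc : Integrable fun x ↦ max (-f x) 0 * Real.cosh (x / 2) := sw_integrable_negPart_mul hfc hfs hcosh
  have h7 : 4 * Cp * Cm ≤ ∫ x, max (-f x) 0 *
      ∫ y, (min (weilArchDensity |x - y|) 5 + min (weilArchDensity |x + y|) 5) * max (f y) 0 := by
    calc 4 * Cp * Cm = ∫ x, max (-f x) 0 * (4 * Real.cosh (x / 2) * Cp) := by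
          rw [hCm, ← integral_const_mul]
          refine integral_congr_ae (Eventually.of_forall fun x ↦ ?_); simp only; ring
      _ ≤ _ := integral_mono (by
            have := hmc.const_mul (4 * Cp)
            refine this.congr (Eventually.of_forall fun x ↦ ?_); simp only; ring) iM' h6
  -- (4) assemble
  have hP := swe_weilPoleForm_abs_sub_eq_even hfc hfs hfe
  have h8 : ∫ x, max (-f x) 0 *
      ∫ t, min (weilArchDensity |t|) 5 * (max (f (x + t)) 0 + max (f (x - t)) 0) =
      ∫ x, max (-f x) 0 *
        ∫ y, (min (weilArchDensity |x - y|) 5 + min (weilArchDensity |x + y|) 5) * max (f y) 0 :=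
    integral_congr_ae (Eventually.of_forall fun x ↦ by simp only; rw [h5 x])
  rw [hP]
  rw [h3, h4, h8] at h2
  have hfin : 8 * Cp * Cm ≤ ∫ t in Ioi (0 : ℝ), min (weilArchDensity t) 5 * G t := by linarith
  simpa only [hGdef] using hfin

end GainPolar

/-! ## The main lemma in the even sector -/

section Main

variable {f : ℝ → ℝ} {a : ℝ}

/-- **Main lemma (sign improvement in the even sector, `0 < a ≤ 1/4`).**  Let `f` be a real smooth
EVEN function with `tsupport f ⊆ [-a, a]` and `‖f‖₂ = 1`.  For every `δ > 0` some approximant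
`w_η = ψ_η ∘ f` (`η > 0`; smooth, even, NON-NEGATIVE, `tsupport w_η ⊆ tsupport f`) has `‖w_η‖₂ > 0` and
`Re Q(w_η) < ‖w_η‖₂² (Re Q(f) + δ)`. [folklore] -/
theorem swe_exists_nonneg_test_lt_even (hf : ContDiff ℝ (⊤ : ℕ∞) f) (hfs : HasCompactSupport f)
    (ha : 0 < a) (ha' : a ≤ 1 / 4) (hsupp : tsupport f ⊆ Icc (-a) a) (hfe : ∀ t, f (-t) = f t)
    (hnorm : ∫ t, ‖((f t : ℝ) : ℂ)‖ ^ 2 = 1) {δ : ℝ} (hδ : 0 < δ) :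
    ∃ η : ℝ, 0 < η ∧ 0 < ∫ t, ‖((Real.sqrt (f t ^ 2 + η ^ 2) - η : ℝ) : ℂ)‖ ^ 2 ∧
      (weilQuadratic (fun t ↦ ((Real.sqrt (f t ^ 2 + η ^ 2) - η : ℝ) : ℂ))).re <
        (∫ t, ‖((Real.sqrt (f t ^ 2 + η ^ 2) - η : ℝ) : ℂ)‖ ^ 2) *
          ((weilQuadratic (fun t ↦ ((f t : ℝ) : ℂ))).re + δ) := by
  have hfc : Continuous f := hf.continuous
  have hsupp' : Function.support f ⊆ Icc (-a) a := (subset_tsupport f).trans hsupp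
  have hF : IsWeilTest fun t ↦ ((f t : ℝ) : ℂ) := sw_isWeilTest_ofReal_comp hf hfs
  have hFs : tsupport (fun t ↦ ((f t : ℝ) : ℂ)) ⊆ Icc (-a) a := (sw_tsupport_ofReal_comp f).symm ▸ hsupp
  -- notation
  set QF : ℝ := (weilQuadratic (fun t ↦ ((f t : ℝ) : ℂ))).re with hQF
  set PF : ℝ := weilPoleForm (fun t ↦ ((f t : ℝ) : ℂ)) with hPF
  set PA : ℝ := weilPoleForm (fun t ↦ ((|f t| : ℝ) : ℂ)) with hPA
  set M : ℝ := weilMarkovConstant a with hM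
  set Nw : ℝ → ℝ := fun η ↦ ∫ t, ‖((Real.sqrt (f t ^ 2 + η ^ 2) - η : ℝ) : ℂ)‖ ^ 2 with hNw
  set Pw : ℝ → ℝ := fun η ↦ weilPoleForm (fun t ↦ ((Real.sqrt (f t ^ 2 + η ^ 2) - η : ℝ) : ℂ))
    with hPw
  set Γ : ℝ → ℝ := fun η ↦ ∫ t in Ioi (0 : ℝ), min (weilArchDensity t) 5 *
      (weilIncrement (fun x ↦ ((f x : ℝ) : ℂ)) t -
        weilIncrement (fun x ↦ ((Real.sqrt (f x ^ 2 + η ^ 2) - η : ℝ) : ℂ)) t) with hΓ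
  set Γ0 : ℝ := ∫ t in Ioi (0 : ℝ), min (weilArchDensity t) 5 *
      (weilIncrement (fun x ↦ ((f x : ℝ) : ℂ)) t - weilIncrement (fun x ↦ ((|f x| : ℝ) : ℂ)) t)
    with hΓ0
  set U : ℝ → ℝ := fun η ↦ QF + (Pw η - PF) - Γ η - M * (Nw η - 1) - Nw η * (QF + δ) with hU
  -- (1) the per-`η` inequality from the Markov decomposition
  have hUle : ∀ η : ℝ, 0 < η →
      (weilQuadratic (fun t ↦ ((Real.sqrt (f t ^ 2 + η ^ 2) - η : ℝ) : ℂ))).re - Nw η * (QF + δ) ≤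
        U η := by
    intro η hη
    have hW : IsWeilTest fun t ↦ ((Real.sqrt (f t ^ 2 + η ^ 2) - η : ℝ) : ℂ) :=
      sw_isWeilTest_psi_comp hf hfs hη
    have hWs : tsupport (fun t ↦ ((Real.sqrt (f t ^ 2 + η ^ 2) - η : ℝ) : ℂ)) ⊆ Icc (-a) a :=
      (sw_tsupport_psi_comp_subset hη.le).trans hsupp
    have h1 := weilQuadratic_re_eq_weilPoleForm_add_weilDirichletEnergy_sub hW hWs
    have h2 := weilQuadratic_re_eq_weilPoleForm_add_weilDirichletEnergy_sub hF hFs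
    have h3 := swe_weilDirichletEnergy_sub_le_neg_gain hf hfs a hη
    rw [hnorm] at h2
    simp only [hU, hNw, hPw, hΓ, hQF, hPF, hM]
    rw [h1]
    linarith
  -- (2) the limit of `U`
  have hN : Tendsto Nw (𝓝[>] 0) (𝓝 1) := by
    have h := sw_tendsto_integral_norm_sq_psi hfc hfs
    rwa [hnorm] at h
  have hP : Tendsto Pw (𝓝[>] 0) (𝓝 PA) := sw_tendsto_weilPoleForm_psi hfc hsupp'
  have hG : Tendsto Γ (𝓝[>] 0) (𝓝 Γ0) := swe_tendsto_gain hf hfs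
  set U0 : ℝ := QF + (PA - PF) - Γ0 - M * (1 - 1) - 1 * (QF + δ) with hU0
  have hUlim : Tendsto U (𝓝[>] 0) (𝓝 U0) := by
    have t1 : Tendsto (fun η ↦ QF + (Pw η - PF)) (𝓝[>] 0) (𝓝 (QF + (PA - PF))) :=
      tendsto_const_nhds.add (hP.sub tendsto_const_nhds)
    have t3 : Tendsto (fun η ↦ M * (Nw η - 1)) (𝓝[>] 0) (𝓝 (M * (1 - 1))) :=
      (hN.sub tendsto_const_nhds).const_mul M
    have t4 : Tendsto (fun η ↦ Nw η * (QF + δ)) (𝓝[>] 0) (𝓝 (1 * (QF + δ))) :=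
      hN.mul tendsto_const_nhds
    rw [hU, hU0]
    exact (((t1.sub hG).sub t3).sub t4)
  -- (3) the limit is negative: polar loss ≤ truncated gain
  have hgain : PA - PF ≤ Γ0 := swe_polar_le_gain hf hfs ha ha' hsupp hfe
  have hU0neg : U0 < 0 := by
    simp only [hU0]
    linarith
  -- (4) pick `η`
  have hev1 : ∀ᶠ η in 𝓝[>] (0 : ℝ), U η < 0 := (tendsto_order.1 hUlim).2 _ hU0neg
  have hev2 : ∀ᶠ η in 𝓝[>] (0 : ℝ), 1 / 2 < Nw η := (tendsto_order.1 hN).1 _ (by norm_num)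
  have hev3 : ∀ᶠ η in 𝓝[>] (0 : ℝ), 0 < η := self_mem_nhdsWithin
  obtain ⟨η, hη1, hη2, hη3⟩ := (hev1.and (hev2.and hev3)).exists
  refine ⟨η, hη3, by simp only [hNw] at hη2; linarith, ?_⟩
  have h := hUle η hη3
  simp only [hNw] at h hη2 ⊢
  linarith

end Main

end Summit.RiemannHypothesis.RiemannHypothesis.Theorems.PolarPerronFrobenius

end
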